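import Mathlib
import Literature.Computability.Complexity.CNF
import Summits.PneNP.PneNP.Theorems.OverlapGapAlgebraSolvableImpliesStableSectionEngine
import Summits.PneNP.PneNP.Theorems.OverlapGapAlgebraSearchHardWindowLipschitzRungDegree
import Summits.PneNP.PneNP.Theorems.OverlapGapAlgebraSolvableImpliesStableSectionLipschitzTransferBoost
import Summits.PneNP.PneNP.Theorems.OverlapGapAlgebraSolvableImpliesStableSectionLipschitzTransferTypicalBoost

/-!
# PneNP / OverlapGapAlgebra — crux `SolvableImpliesStableSection` (stmt-PneNP-2463):
# the TYPICALLY-Lipschitz transfer (3/3) — the crux holds for solvers Lipschitz on sparse instances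

Support for crux `stmt-PneNP-2463` (`Summit.PneNP.PneNP.Theses.OverlapGapAlgebra.SolvableImpliesStableSection`).
Strengthening of the Lipschitz transfer (`sissLip_solvableImpliesStableSection_of_lipschitz`): the solver's
section is only required to be `s(n)`-Lipschitz (Hamming output, per single-literal change) at instances
whose maximum clause-degree is at most `3 log n` — the regime of every instance but a `O(n^{-3})`
fraction (`shwL_card_maxdeg_gt_le_real`). This is the honest home of radius-`r` local rules and
`O(1)`-round message passing, whose Lipschitz constant is polynomial in the maximum clause-degree
(hence `polylog n` on such instances, and `s(n)² log³ n = o(n)` holds) but of order `m` in the worst case.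

* `sissT_concl_of_typLipschitzSolver` — map form: a typically-`s(n)`-Lipschitz map solving `≥ ε·#Inst`
  instances infinitely often gives the conclusion of the crux for all `c > 0` (jump mass
  `≤ mk·#{exceptional}·2n`, engine `engine_count` with growing loss rate, `sissLip_numerics` at `ν/√2`).
* `sissT_solvableImpliesStableSection_of_typLipschitz` — the crux VERBATIM with `IsPolyTime f` replaced by
  "eventually the decoded section of `f` is `s(n)`-Lipschitz at instances of maximum clause-degree
  `≤ 3 log n`", for all `k ≥ 1`, `α, η, ν > 0`, `s(n)² log³ n = o(n)`.
No new definitions; axioms `propext`, `Classical.choice`, `Quot.sound`.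
-/

set_option linter.dupNamespace false -- `Summit.PneNP.PneNP.…`: summit = sub-problem (D-0017)

namespace Summit.PneNP.PneNP.Theorems

open Finset Filter Asymptotics
open scoped Classical


/-- **The typically-Lipschitz transfer (map form).** For every `k ≥ 1`, `α, η, ν > 0`, every `s` with
`s(n)² log³ n = o(n)` and every `ε > 0`: if, for infinitely many `n` (`m = ⌊α n⌋₊`), some map `g` that
is `s(n)`-Lipschitz in Hamming output per single-literal change AT EVERY INSTANCE OF MAXIMUM
CLAUSE-DEGREE `≤ 3 log n` satisfies at least `ε·#Inst` instances of `F_k(n, m)`, then for every `c > 0`,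
infinitely often, some map (such a `g` itself) realises the path event of `SolvableImpliesStableSection`
on at least `e^{-cn}·#paths` of the path tuples. (Exceptional instances, of maximum clause-degree
`> ⌈2 log n⌉₊`, are a `O(n^{-3})` fraction: they are charged `m²` in the variance and counted whole in
the jump mass; everything else is as in the Lipschitz transfer.) -/
theorem sissT_concl_of_typLipschitzSolver (k : ℕ) (hk : 1 ≤ k) (α η ν : ℝ) (hα : 0 < α)
    (hη : 0 < η) (hν : 0 < ν) (s : ℕ → ℝ)
    (hs : (fun n : ℕ => s n ^ 2 * Real.log n ^ 3) =o[atTop] (fun n : ℕ => (n : ℝ)))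
    (ε : ℝ) (hε : 0 < ε)
    (hsolv : ∃ᶠ n : ℕ in atTop, ∀ m : ℕ, m = ⌊α * n⌋₊ →
      ∃ g : (Fin m → Fin k → Fin n × Bool) → (Fin n → Bool),
        (∀ (Φ : Fin m → Fin k → Fin n × Bool),
          (((univ : Finset (Fin n)).sup fun v =>
            ((univ : Finset (Fin m)).filter fun i => ∃ j, (Φ i j).1 = v).card : ℕ) : ℝ)
              ≤ 3 * Real.log n →
          ∀ (a : Fin m) (b : Fin k) (ℓ : Fin n × Bool),
            (hammingDist (g Φ) (g (Function.update Φ a (Function.update (Φ a) b ℓ))) : ℝ) ≤ s n) ∧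
        ε * Fintype.card (Fin m → Fin k → Fin n × Bool) ≤
          ((Finset.univ.filter fun Φ : Fin m → Fin k → Fin n × Bool =>
            ∀ i, ∃ j, g Φ (Φ i j).1 = (Φ i j).2).card : ℝ))
    (c : ℝ) (hc : 0 < c) :
    ∃ᶠ n : ℕ in atTop, ∀ m : ℕ, m = ⌊α * n⌋₊ →
      ∃ g : (Fin m → Fin k → Fin n × Bool) → (Fin n → Bool),
        Real.exp (-(c * n)) * Fintype.card (Fin (k + 1) → Fin m → Fin k → Fin n × Bool) ≤
        ((Finset.univ.filter fun Ψ : Fin (k + 1) → Fin m → Fin k → Fin n × Bool =>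
          let P : Fin k → ℕ → Fin m → Fin k → Fin n × Bool :=
            fun r q a b => if (a : ℕ) * k + b < q then Ψ r.succ a b else Ψ r.castSucc a b
          (∀ r : Fin k, ∀ q ≤ m * k, ((Finset.univ.filter fun i : Fin m =>
            ∀ j, g (P r q) (P r q i j).1 ≠ (P r q i j).2).card : ℝ) ≤ ν * m) ∧
          ∀ r : Fin k, ∀ q < m * k,
            (hammingDist (g (P r q)) (g (P r (q + 1))) : ℝ) ≤ η * n).card : ℝ) := by
  have hkR : (1 : ℝ) ≤ k := by exact_mod_cast hk
  have hk0 : (0 : ℝ) < k := by linarith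
  -- the halved validity parameter `ν' = ν/√2`
  obtain ⟨ν', hν', hν'2⟩ : ∃ ν' : ℝ, 0 < ν' ∧ ν' ^ 2 = ν ^ 2 / 2 := by
    refine ⟨ν / Real.sqrt 2, by positivity, ?_⟩
    rw [div_pow, Real.sq_sqrt (by norm_num)]
  -- the small constant `δ`
  obtain ⟨δ, hδpos, hδ1, hδa, hδc, hδb⟩ : ∃ δ : ℝ, 0 < δ ∧ δ ≤ 1 ∧
      δ ≤ ε * ν' ^ 2 * α / (160 * k ^ 2) ∧ δ ≤ c * ν' ^ 2 / (1280 * k ^ 4) ∧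
      δ ≤ α * ν' ^ 2 / (1280 * k ^ 3) := by
    refine ⟨min 1 (min (ε * ν' ^ 2 * α / (160 * k ^ 2))
      (min (c * ν' ^ 2 / (1280 * k ^ 4)) (α * ν' ^ 2 / (1280 * k ^ 3)))), ?_, min_le_left _ _,
      (min_le_right _ _).trans (min_le_left _ _),
      ((min_le_right _ _).trans (min_le_right _ _)).trans (min_le_left _ _),
      ((min_le_right _ _).trans (min_le_right _ _)).trans (min_le_right _ _)⟩
    refine lt_min zero_lt_one (lt_min ?_ (lt_min ?_ ?_)) <;> positivity
  -- eventual conditions in `n`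
  have C0 : ∀ᶠ n : ℕ in atTop, 8 ≤ n := eventually_ge_atTop 8
  have C1 : ∀ᶠ n : ℕ in atTop, s n ^ 2 * Real.log n ^ 3 ≤ δ * n := by
    filter_upwards [hs.def hδpos] with n hn
    rw [Real.norm_eq_abs, Real.norm_eq_abs, Nat.abs_cast] at hn
    exact (le_abs_self _).trans hn
  have C2 := shwL_sum_maxdeg_sq_le k hα.le
  have C3 : ∀ᶠ n : ℕ in atTop, (8 + ε * ν' ^ 2) * 2 / (ε * ν' ^ 2 * α) ≤ (n : ℝ) :=
    tendsto_natCast_atTop_atTop.eventually_ge_atTop _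
  have C4 : ∀ᶠ n : ℕ in atTop, (1 + 32 * k ^ 2 / ν' ^ 2) * Real.log n ≤ c * n / 2 := by
    have hlo := Real.isLittleO_log_id_atTop.comp_tendsto tendsto_natCast_atTop_atTop
    have hK : (0 : ℝ) < 1 + 32 * k ^ 2 / ν' ^ 2 := by positivity
    have hpos : 0 < c / (2 * (1 + 32 * k ^ 2 / ν' ^ 2)) := by positivity
    filter_upwards [hlo.def hpos] with n hn
    simp only [Function.comp_apply, id_eq, Real.norm_eq_abs, Nat.abs_cast] at hn
    have h1 : Real.log n ≤ c / (2 * (1 + 32 * k ^ 2 / ν' ^ 2)) * n := (le_abs_self _).trans hn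
    calc (1 + 32 * k ^ 2 / ν' ^ 2) * Real.log n
        ≤ (1 + 32 * k ^ 2 / ν' ^ 2) * (c / (2 * (1 + 32 * k ^ 2 / ν' ^ 2)) * n) :=
          mul_le_mul_of_nonneg_left h1 hK.le
      _ = c * n / 2 := by field_simp
  have C5 : ∀ᶠ n : ℕ in atTop, 2 * (16 * k ^ 2 / ν' ^ 2 + 1 + k ^ 2) / (k ^ 2 * α) ≤ (n : ℝ) :=
    tendsto_natCast_atTop_atTop.eventually_ge_atTop _
  have C6 : ∀ᶠ n : ℕ in atTop, 1 / η ^ 2 ≤ (n : ℝ) :=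
    tendsto_natCast_atTop_atTop.eventually_ge_atTop _
  have C7 : ∀ᶠ n : ℕ in atTop, α ^ 2 * Real.exp (α * k * Real.exp 2) ≤ (n : ℝ) :=
    tendsto_natCast_atTop_atTop.eventually_ge_atTop _
  have C8 : ∀ᶠ n : ℕ in atTop, α * ν ^ 2 * Real.exp (α * k * Real.exp 2) ≤ (n : ℝ) :=
    tendsto_natCast_atTop_atTop.eventually_ge_atTop _
  have hev : ∀ᶠ n : ℕ in atTop, 8 ≤ n ∧ s n ^ 2 * Real.log n ^ 3 ≤ δ * n ∧
      (∀ m : ℕ, (m : ℝ) ≤ α * n →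
        ∑ Φ : Fin m → Fin k → Fin n × Bool,
            (((univ : Finset (Fin n)).sup fun v =>
              ((univ : Finset (Fin m)).filter fun i => ∃ j, (Φ i j).1 = v).card : ℕ) : ℝ) ^ 2
          ≤ 10 * Real.log n ^ 2 * Fintype.card (Fin m → Fin k → Fin n × Bool)) ∧
      (8 + ε * ν' ^ 2) * 2 / (ε * ν' ^ 2 * α) ≤ (n : ℝ) ∧
      (1 + 32 * k ^ 2 / ν' ^ 2) * Real.log n ≤ c * n / 2 ∧
      2 * (16 * k ^ 2 / ν' ^ 2 + 1 + k ^ 2) / (k ^ 2 * α) ≤ (n : ℝ) ∧ 1 / η ^ 2 ≤ (n : ℝ) ∧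
      α ^ 2 * Real.exp (α * k * Real.exp 2) ≤ (n : ℝ) ∧
      α * ν ^ 2 * Real.exp (α * k * Real.exp 2) ≤ (n : ℝ) := by
    filter_upwards [C0, C1, C2, C3, C4, C5, C6, C7, C8] with n h0 h1 h2 h3 h4 h5 h6 h7 h8
    exact ⟨h0, h1, h2, h3, h4, h5, h6, h7, h8⟩
  refine (hsolv.and_eventually hev).mono ?_
  rintro n ⟨hn, hn8, hC1, hC2, hC3, hC4, hC5, hC6, hC7, hC8⟩ m hm
  obtain ⟨g, hg, hsucc⟩ := hn m hm
  refine ⟨g, ?_⟩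
  -- numerics of `n` and `m`
  have hn3 : 3 ≤ n := le_trans (by norm_num) hn8
  have hn1 : 1 ≤ n := le_trans (by norm_num) hn8
  have hnR : (1 : ℝ) ≤ n := by exact_mod_cast hn1
  have hn8R : (8 : ℝ) ≤ n := by exact_mod_cast hn8
  have hnpos : (0 : ℝ) < n := by linarith only [hnR]
  have hxpos : (0 : ℝ) < 2 * n := by linarith only [hnR]
  have hlog2le : Real.log 2 ≤ Real.log (2 * n) := Real.log_le_log two_pos (by linarith only [hnR])
  have hlog2 : 2 ≤ Real.log n := by
    rw [← Real.log_exp 2]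
    apply Real.log_le_log (Real.exp_pos 2)
    have he : Real.exp 2 ≤ 8 := by
      have h1 : Real.exp 1 < 2.7182818286 := Real.exp_one_lt_d9
      have h2 : Real.exp 2 = Real.exp 1 * Real.exp 1 := by rw [← Real.exp_add]; norm_num
      rw [h2]
      have h3 := mul_lt_mul'' h1 h1 (Real.exp_pos 1).le (Real.exp_pos 1).le
      have h4 : (2.7182818286 : ℝ) * 2.7182818286 ≤ 8 := by norm_num
      exact (h3.le.trans h4)
    exact he.trans hn8R
  have hm_le : (m : ℝ) ≤ α * n := by rw [hm]; exact Nat.floor_le (by positivity)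
  have hm_ge : α * n - 1 ≤ m := by
    rw [hm]; have := Nat.lt_floor_add_one (α * n); linarith only [this]
  -- a nonnegative Lipschitz constant `s' ≥ s n`
  obtain ⟨s', hs'0, hs'ge, hs'sq⟩ : ∃ s' : ℝ, 0 ≤ s' ∧ s n ≤ s' ∧ s' ^ 2 ≤ s n ^ 2 := by
    refine ⟨max (s n) 0, le_max_right _ _, le_max_left _ _, ?_⟩
    rcases le_or_gt 0 (s n) with h | h
    · rw [max_eq_left h]
    · rw [max_eq_right h.le, zero_pow two_ne_zero]
      exact sq_nonneg _
  have hC1' : s' ^ 2 * Real.log n ^ 3 ≤ δ * n :=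
    (mul_le_mul_of_nonneg_right hs'sq (by positivity)).trans hC1
  obtain ⟨hm1, hs'η, h8B, ht, hMB⟩ := sissLip_numerics k hk α η ν' ε c δ s' hα hη hν' hε hc hs'0
    hδ1 hδa hδc hδb n m hn3 hC1' hC3 hC4 hC5 hC6 hm_ge
  have hmR : (1 : ℝ) ≤ m := by exact_mod_cast hm1
  have hmpos' : (0 : ℝ) < m := by linarith only [hmR]
  -- the degree level `L = ⌈2 log n⌉₊` and the Lipschitz hypothesis at level `L + 1`
  set L : ℕ := ⌈2 * Real.log n⌉₊ with hL
  have hLge : 2 * Real.log n ≤ L := Nat.le_ceil _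
  have hLle : (L : ℝ) ≤ 2 * Real.log n + 1 := by
    have := Nat.ceil_lt_add_one (show 0 ≤ 2 * Real.log n by positivity)
    exact le_of_lt this
  have hg' : ∀ (Φ : Fin m → Fin k → Fin n × Bool),
      ((univ : Finset (Fin n)).sup fun v =>
        ((univ : Finset (Fin m)).filter fun i => ∃ j, (Φ i j).1 = v).card) ≤ L + 1 →
      ∀ (a : Fin m) (b : Fin k) (ℓ : Fin n × Bool),
        (hammingDist (g Φ) (g (Function.update Φ a (Function.update (Φ a) b ℓ))) : ℝ) ≤ s' := by
    intro Φ hΦ a b ℓ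
    refine (hg Φ ?_ a b ℓ).trans hs'ge
    have h1 : (((univ : Finset (Fin n)).sup fun v =>
        ((univ : Finset (Fin m)).filter fun i => ∃ j, (Φ i j).1 = v).card : ℕ) : ℝ) ≤ (L : ℝ) + 1 := by
      exact_mod_cast hΦ
    linarith only [h1, hLle, hlog2]
  -- the exceptional set (maximum clause-degree `> L`) is negligible
  haveI : Nonempty (Fin n × Bool) := ⟨(⟨0, hn1⟩, true)⟩
  set N : ℝ := (Fintype.card (Fin m → Fin k → Fin n × Bool) : ℝ) with hN
  have hNpos : 0 < N := by rw [hN]; exact_mod_cast Fintype.card_pos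
  obtain ⟨BadS, hBadS⟩ : ∃ BadS : Finset (Fin m → Fin k → Fin n × Bool),
      BadS = (univ : Finset (Fin m → Fin k → Fin n × Bool)).filter fun Φ =>
        L < (univ : Finset (Fin n)).sup fun v =>
          ((univ : Finset (Fin m)).filter fun i => ∃ j, (Φ i j).1 = v).card := ⟨_, rfl⟩
  obtain ⟨hBad, hBadjump⟩ := sissT_bad_bounds (m := m) (k := k) (n := n) hn1 α ν hα.le hν L hm_le
    hLge hC7 hC8
  rw [← hBadS] at hBadjump
  -- the loss rate `A = 4k(1 + 10k²s'²log²n)/ν'² = 8k(1 + 10k²s'²log²n)/ν²` and the good set `G`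
  obtain ⟨A, hA⟩ : ∃ A : ℝ, A = 4 * k * (1 + 10 * k ^ 2 * s' ^ 2 * Real.log n ^ 2) / ν' ^ 2 :=
    ⟨_, rfl⟩
  have hA0 : 0 ≤ A := by rw [hA]; positivity
  have hAeq : A = (8 * k + 8 * k * (10 * k ^ 2 * s' ^ 2 * Real.log n ^ 2)) / ν ^ 2 := by
    rw [hA, hν'2]
    field_simp
    ring
  have hkx : 0 ≤ (k : ℝ) * (10 * k ^ 2 * s' ^ 2 * Real.log n ^ 2) := by positivity
  have hν2 : 0 < ν ^ 2 := by positivity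
  have hA8 : 8 * k / ν ^ 2 ≤ A := by
    rw [hAeq]
    exact div_le_div_of_nonneg_right (by linarith only [hkx]) hν2.le
  have hAge : 4 * k * (2 + 10 * k ^ 2 * s' ^ 2 * Real.log n ^ 2) / ν ^ 2 ≤ A := by
    rw [hAeq]
    apply div_le_div_of_nonneg_right _ hν2.le
    have : 4 * (k : ℝ) * (2 + 10 * k ^ 2 * s' ^ 2 * Real.log n ^ 2)
        = 8 * k + 4 * (k * (10 * k ^ 2 * s' ^ 2 * Real.log n ^ 2)) := by ring
    rw [this]
    linarith only [hkx]
  rw [← hA] at ht hMB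
  have h8B' : 8 * (2 + 10 * k ^ 2 * s' ^ 2 * Real.log n ^ 2) ≤ ε * ν ^ 2 * m := by
    rw [hν'2] at h8B
    have : 0 ≤ 10 * (k : ℝ) ^ 2 * s' ^ 2 * Real.log n ^ 2 := by positivity
    linarith only [h8B, this]
  obtain ⟨G, hGdef⟩ : ∃ G : Finset (Fin m → Fin k → Fin n × Bool),
      G = (univ : Finset (Fin m → Fin k → Fin n × Bool)).filter fun Φ =>
        ((((univ : Finset (Fin m)).filter fun i => ∀ j, g Φ (Φ i j).1 ≠ (Φ i j).2).card : ℕ) : ℝ)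
          ≤ ν * m := ⟨_, rfl⟩
  have hval : ∀ Φ ∈ G, ((((univ : Finset (Fin m)).filter fun i =>
      ∀ j, g Φ (Φ i j).1 ≠ (Φ i j).2).card : ℕ) : ℝ) ≤ ν * m := fun Φ hΦ => by
    rw [hGdef] at hΦ
    exact (Finset.mem_filter.1 hΦ).2
  have hG : ((k * m : ℕ) : ℝ) * (Gᶜ.card : ℝ) ≤ A * Fintype.card (Fin m → Fin k → Fin n × Bool) := by
    have h := sissT_km_card_invalid_le hn1 hm1 g s' ν ε hs'0 hν hε L hg' (hC2 m hm_le) hBad hsucc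
      h8B' G hGdef
    exact h.trans (mul_le_mul_of_nonneg_right hAge (Nat.cast_nonneg _))
  -- jump mass: only exceptional instances can jump by more than `s' ≤ η n`
  have hjump : (∑ a : Fin m, ∑ b : Fin k,
      (((Finset.univ : Finset ((Fin m → Fin k → Fin n × Bool) × (Fin n × Bool))).filter
        fun p => η * n < hammingDist (g p.1)
          (g (Function.update p.1 a (Function.update (p.1 a) b p.2)))).card : ℝ))
      ≤ A * (Fintype.card (Fin m → Fin k → Fin n × Bool) * (2 * n)) := by
    have hone : ∀ (a : Fin m) (b : Fin k),
        (((Finset.univ : Finset ((Fin m → Fin k → Fin n × Bool) × (Fin n × Bool))).filter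
          fun p => η * n < hammingDist (g p.1)
            (g (Function.update p.1 a (Function.update (p.1 a) b p.2)))).card : ℝ)
          ≤ (BadS.card : ℝ) * (2 * n) := by
      intro a b
      have hsub : ((Finset.univ : Finset ((Fin m → Fin k → Fin n × Bool) × (Fin n × Bool))).filter
          fun p => η * n < hammingDist (g p.1)
            (g (Function.update p.1 a (Function.update (p.1 a) b p.2))))
          ⊆ BadS ×ˢ (univ : Finset (Fin n × Bool)) := by
        intro p hp
        simp only [Finset.mem_filter, Finset.mem_univ, true_and] at hp
        rw [Finset.mem_product]
        refine ⟨?_, Finset.mem_univ _⟩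
        rw [hBadS, Finset.mem_filter]
        refine ⟨Finset.mem_univ _, ?_⟩
        by_contra hle
        push Not at hle
        have h1 := hg' p.1 (hle.trans (Nat.le_succ L)) a b p.2
        exact absurd (h1.trans hs'η) (not_le.2 hp)
      have hcard := Finset.card_le_card hsub
      rw [Finset.card_product, Finset.card_univ, Fintype.card_prod, Fintype.card_fin,
        Fintype.card_bool] at hcard
      have : (((Finset.univ : Finset ((Fin m → Fin k → Fin n × Bool) × (Fin n × Bool))).filter
          fun p => η * n < hammingDist (g p.1)
            (g (Function.update p.1 a (Function.update (p.1 a) b p.2)))).card : ℝ)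
          ≤ ((BadS.card * (n * 2) : ℕ) : ℝ) := by exact_mod_cast hcard
      push_cast at this
      linarith only [this]
    calc (∑ a : Fin m, ∑ b : Fin k,
        (((Finset.univ : Finset ((Fin m → Fin k → Fin n × Bool) × (Fin n × Bool))).filter
          fun p => η * n < hammingDist (g p.1)
            (g (Function.update p.1 a (Function.update (p.1 a) b p.2)))).card : ℝ))
        ≤ ∑ _a : Fin m, ∑ _b : Fin k, (BadS.card : ℝ) * (2 * n) :=
          Finset.sum_le_sum fun a _ => Finset.sum_le_sum fun b _ => hone a b
      _ = ((m * k : ℕ) : ℝ) * (BadS.card : ℝ) * (2 * n) := by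
          simp only [Finset.sum_const, Finset.card_univ, Fintype.card_fin, nsmul_eq_mul]
          push_cast; ring
      _ ≤ (8 * k / ν ^ 2 * N) * (2 * n) := mul_le_mul_of_nonneg_right hBadjump (by positivity)
      _ ≤ (A * N) * (2 * n) := by
          apply mul_le_mul_of_nonneg_right _ (by positivity)
          exact mul_le_mul_of_nonneg_right hA8 hNpos.le
      _ = A * (Fintype.card (Fin m → Fin k → Fin n × Bool) * (2 * n)) := by rw [hN]; ring
  -- the engine and the growing-loss asymptotics
  have hE := Summit.PneNP.PneNP.Cruxes.SolvableImpliesStableSection.Sketch.engine_count k m n hn1 η A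
    hη.le hA0 g G hG hjump
  have hasym := sissLip_asy_pointwise (M := m * k) (k := k) (Real.exp_log hxpos) hlog2le ht hMB
  -- assembly (as in `concl_of_smoothSection`)
  have hpaths : (Fintype.card (Fin (k + 1) → Fin m → Fin k → Fin n × Bool) : ℝ) =
      (2 * n) ^ (m * k * (k + 1)) := by
    rw [Summit.PneNP.PneNP.Cruxes.SolvableImpliesStableSection.Sketch.eng_card_paths]
    push_cast
    ring
  have hmono : ((univ : Finset (Fin (k + 1) → Fin m → Fin k → Fin n × Bool)).filter fun Ψ =>
          (∀ r : Fin k, ∀ q ≤ m * k,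
            (fun (a : Fin m) (b : Fin k) =>
              if (a : ℕ) * k + b < q then Ψ r.succ a b else Ψ r.castSucc a b) ∈ G) ∧
          ∀ r : Fin k, ∀ q < m * k,
            (hammingDist
              (g fun (a : Fin m) (b : Fin k) =>
                if (a : ℕ) * k + b < q then Ψ r.succ a b else Ψ r.castSucc a b)
              (g fun (a : Fin m) (b : Fin k) =>
                if (a : ℕ) * k + b < q + 1 then Ψ r.succ a b else Ψ r.castSucc a b) : ℝ)
              ≤ η * n).card ≤
      ((univ : Finset (Fin (k + 1) → Fin m → Fin k → Fin n × Bool)).filter fun Ψ =>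
        let P : Fin k → ℕ → Fin m → Fin k → Fin n × Bool :=
          fun r q a b => if (a : ℕ) * k + b < q then Ψ r.succ a b else Ψ r.castSucc a b
        (∀ r : Fin k, ∀ q ≤ m * k, (((Finset.univ : Finset (Fin m)).filter fun i =>
          ∀ j, g (P r q) (P r q i j).1 ≠ (P r q i j).2).card : ℝ) ≤ ν * m) ∧
        ∀ r : Fin k, ∀ q < m * k,
          (hammingDist (g (P r q)) (g (P r (q + 1))) : ℝ) ≤ η * n).card := by
    refine Finset.card_le_card fun Ψ hΨ => ?_
    simp only [Finset.mem_filter, Finset.mem_univ, true_and] at hΨ ⊢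
    obtain ⟨hin, hjmp⟩ := hΨ
    exact ⟨fun r q hq => hval _ (hin r q hq), fun r q hq => hjmp r q hq⟩
  have hmono' := (Nat.cast_le (α := ℝ)).2 hmono
  rw [hpaths]
  linarith only [hasym, hE, hmono']

/-- **The typically-Lipschitz transfer: `SolvableImpliesStableSection` HOLDS on the class of solvers whose
sections are Lipschitz on sparse instances.** For every `k ≥ 1`, `α, η, ν > 0` and `s` with
`s(n)² log³ n = o(n)`: the crux `SolvableImpliesStableSection` verbatim, with its hypothesis `IsPolyTime f`
REPLACED by "eventually in `n`, the decoded section `Φ ↦ (v ↦ (f ⌜Φ⌝).getD v false)` of `f` on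
`F_k(n, ⌊α n⌋₊)` is `s(n)`-Lipschitz in Hamming output per single-literal change at every instance of
maximum clause-degree `≤ 3 log n`" (no complexity hypothesis; nothing is asked at denser instances). -/
theorem sissT_solvableImpliesStableSection_of_typLipschitz (k : ℕ) (hk : 1 ≤ k) (α η ν : ℝ)
    (hα : 0 < α) (hη : 0 < η) (hν : 0 < ν) (s : ℕ → ℝ)
    (hs : (fun n : ℕ => s n ^ 2 * Real.log n ^ 3) =o[atTop] (fun n : ℕ => (n : ℝ)))
    (hsolv : ∃ f : List Bool → List Bool,
      (∀ᶠ n : ℕ in atTop, ∀ m : ℕ, m = ⌊α * n⌋₊ →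
        ∃ g : (Fin m → Fin k → Fin n × Bool) → (Fin n → Bool),
          (∀ (Φ : Fin m → Fin k → Fin n × Bool) (v : Fin n), g Φ v =
            (f (Literature.Computability.Complexity.encodingCNF.encode (List.ofFn fun a =>
              List.ofFn fun b => (((Φ a b).1 : ℕ), (Φ a b).2)))).getD v false) ∧
          ∀ (Φ : Fin m → Fin k → Fin n × Bool),
            (((univ : Finset (Fin n)).sup fun v =>
              ((univ : Finset (Fin m)).filter fun i => ∃ j, (Φ i j).1 = v).card : ℕ) : ℝ)
                ≤ 3 * Real.log n →
            ∀ (a : Fin m) (b : Fin k) (ℓ : Fin n × Bool),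
              (hammingDist (g Φ) (g (Function.update Φ a (Function.update (Φ a) b ℓ))) : ℝ)
                ≤ s n) ∧
      ∃ ε : ℝ, 0 < ε ∧ ∃ᶠ n : ℕ in Filter.atTop, ∀ m : ℕ, m = ⌊α * n⌋₊ → ε ≤
        ((Finset.univ.filter fun Φ : Fin m → Fin k → Fin n × Bool => ∀ i, ∃ j,
          (f (Literature.Computability.Complexity.encodingCNF.encode (List.ofFn fun a =>
            List.ofFn fun b => (((Φ a b).1 : ℕ), (Φ a b).2)))).getD (Φ i j).1 false =
              (Φ i j).2).card : ℝ) / Fintype.card (Fin m → Fin k → Fin n × Bool))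
    (c : ℝ) (hc : 0 < c) :
    ∃ᶠ n : ℕ in Filter.atTop, ∀ m : ℕ, m = ⌊α * n⌋₊ →
      ∃ g : (Fin m → Fin k → Fin n × Bool) → (Fin n → Bool),
        Real.exp (-(c * n)) * Fintype.card (Fin (k + 1) → Fin m → Fin k → Fin n × Bool) ≤
        ((Finset.univ.filter fun Ψ : Fin (k + 1) → Fin m → Fin k → Fin n × Bool =>
          let P : Fin k → ℕ → Fin m → Fin k → Fin n × Bool :=
            fun r q a b => if (a : ℕ) * k + b < q then Ψ r.succ a b else Ψ r.castSucc a b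
          (∀ r : Fin k, ∀ q ≤ m * k, ((Finset.univ.filter fun i : Fin m =>
            ∀ j, g (P r q) (P r q i j).1 ≠ (P r q i j).2).card : ℝ) ≤ ν * m) ∧
          ∀ r : Fin k, ∀ q < m * k,
            (hammingDist (g (P r q)) (g (P r (q + 1))) : ℝ) ≤ η * n).card : ℝ) := by
  obtain ⟨f, hLip, ε, hε, hfreq⟩ := hsolv
  refine sissT_concl_of_typLipschitzSolver k hk α η ν hα hη hν s hs ε hε ?_ c hc
  refine (hfreq.and_eventually (hLip.and (eventually_ge_atTop 1))).mono ?_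
  rintro n ⟨hn, hLn, hn1⟩ m hm
  obtain ⟨g, hgf, hg⟩ := hLn m hm
  refine ⟨g, hg, ?_⟩
  have h := hn m hm
  haveI : Nonempty (Fin n × Bool) := ⟨(⟨0, hn1⟩, false)⟩
  have hN : (0 : ℝ) < Fintype.card (Fin m → Fin k → Fin n × Bool) := by
    exact_mod_cast Fintype.card_pos
  rw [le_div_iff₀ hN] at h
  have hset : ((Finset.univ.filter fun Φ : Fin m → Fin k → Fin n × Bool => ∀ i, ∃ j,
      (f (Literature.Computability.Complexity.encodingCNF.encode (List.ofFn fun a =>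
        List.ofFn fun b => (((Φ a b).1 : ℕ), (Φ a b).2)))).getD (Φ i j).1 false = (Φ i j).2))
      = (Finset.univ.filter fun Φ : Fin m → Fin k → Fin n × Bool =>
          ∀ i, ∃ j, g Φ (Φ i j).1 = (Φ i j).2) := by
    refine Finset.filter_congr fun Φ _ => ?_
    simp only [hgf]
  rw [hset] at h
  exact h

end Summit.PneNP.PneNP.Theorems
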